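import Literature.NumberTheory.EllipticCurves.Kato2004.IwasawaCohomologyNumberField
import Literature.NumberTheory.EllipticCurves.Kato2004.EulerSystemIsogenyTransport
import HarnessLib

set_option autoImplicit false

/-!
# Functoriality of the `K`-side pinned Iwasawa cohomology `𝐇¹_{K,Γ}(T_pV) = lim← H¹(O_{K_n}[1/p], T_pV)` in `K`-isogenies:
# the push-forward `φ_*` of an isogeny / endomorphism `φ : V → V′` DEFINED OVER THE NUMBER FIELD `K` on every layer
# `H¹(K_n, T_pV)` and on the inverse limit `IwasawaH1DataOver`, with its compatibilities — in particular the action of a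
# CM endomorphism (`φ ∘ φ = [−D]`) on `H¹_Iw(Kℚ_∞/K, T_pW)` (Kato 2004, 15.14: «`O_λ` acts on `H^q(T)` through the lattice»)

Topic `NumberTheory/EllipticCurves`, sub-directory `Kato2004` (namespace = path).  Cell bsd-cm, seat bsd-cm-prr-ty1 g29
(literature-prover), row (K2C-1) of crux `EllipticUnitValueSevenOfGZK` (stmt-BirchSwinnertonDyer-19945): the CONSTRUCTION
half of pin (λ3) of the Summits-side `PinnedKatoGenusFrame` (file `Rank1Residual/Additive/RamifiedSevenGenusKatoPinnedFrame`),
which PINS the uniformiser `π = √−7 ∈ O_𝔭 ⊂ Λ_O` acting on `𝐇′(S′_W) = H¹_Iw(Kℚ_∞/K, T₇W)` as «the operator whose layers are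
`(T₇φ)_*`» — this file CONSTRUCTS that operator on the tree's pinned carrier `IwasawaH1DataOver` for ANY `K`-isogeny, as the
`K`-side twin (verbatim in method) of `Kato2004/EulerSystemIsogenyTransport.lean` (push-forward on `H¹(U, T_pW)` for
`ℚ`-isogenies) composed with the inverse-limit packaging of `IwasawaCohomologyNumberFieldRestriction.lean` (`resOver`).
HONEST FRAMING: definitions with bodies and proved theorems (folklore functoriality); no named fact, no `instance`, no
notation, no `sorry`; nothing about any curve, zeta element or BSD is asserted; no summit statement is touched.

## Contents (all proved)

* §1 `isogenyLayerMapK φ U : H¹(U, T_pV) →ₗ[ℤ_p] H¹(U, T_pV′)` for a `K`-isogeny `φ : V → V′` and `U ≤ Γ_K` (Mathlib's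
  `ContinuousCohomology.map` of the compatible pair `(id_U, T_pφ)`; `= mapH1AddHom` of `T_pφ`), and its compatibilities
  with restriction (`_resLe`), corestriction (`_coresLe`, hence with the layer trace maps `layerCoresOver`), the `Γ_K`-action
  (`_conjMap`), integrality (`_mem_integralH1K`: `H¹(O_{K_n}[1/p], ·)` is preserved — inertia-restriction commutes with
  `φ_*`), and composition with a dual: `ψ ∘ φ = [n] ⇒ ψ_* ∘ φ_* = n` (`_isogenyLayerMapK_of_comp_eq_zsmul`).
* §2 **`IwasawaH1DataOver.isogenyMap φ IK IK′ hγ : IK.H →ₗ[Λ] IK′.H`** for pinned data `IK` of `V` and `IK′` of `V′` along the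
  same `ℤ_p`-extension `κ` of `K` and generator `γ`: THE map with `IK′.proj n (isogenyMap x) = φ_* (IK.proj n x)`
  (`proj_isogenyMap`, `isogenyMap_unique`); `Λ`-linear because `φ_*` commutes with `conj_γ` and both `Λ`-actions are levelwise
  (`IwasawaH1DataOver.proj_smul`).  Consequences: `ψ ∘ φ = [n] ⇒ isogenyMap ψ ∘ isogenyMap φ = n` (`isogenyMap_isogenyMap_of_comp_eq_zsmul`);
  for an ENDOMORPHISM `φ` of `V` with `φ ∘ φ = [m]`: `(isogenyMap φ)² = m` on `𝐇¹_{K,Γ}(T_pV)` (`isogenyMap_sq_of_comp_self_eq_zsmul`)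
  — for a CM curve `W_K`, `φ = √−D`, this is the `O_K ⊗ ℤ_p`-MODULE STRUCTURE of `H¹_Iw(Kℚ_∞/K, T_pW)` through the CM
  endomorphisms (Kato 15.14), the operator pinned as `π` by `PinnedKatoGenusFrame.proj_pi`.

## References
* K. Kato, Astérisque 295 (2004), §8.1 (8.1.3) (p. 180: functoriality of the Euler-system classes in the lattice), §12.2
  (p. 220: `𝐇^q` as inverse limits), 15.14 (p. 264: `H^q(T)` as `O_λ[[G′_∞]]`-module for the `O_λ`-lattice `T`). [Kato2004Asterisque]
* J.-P. Serre, *Galois Cohomology* (1997), I §2.2, §2.4 (functoriality of `H¹` in the coefficients; compatibility with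
  `res`/`cor`). [SerreGaloisCohomology1997]
* J. Neukirch, A. Schmidt, K. Wingberg, *Cohomology of Number Fields* (2008), I §5 Prop. 1.5.4 (compatible pairs),
  (1.5.6)–(1.5.7). [NeukirchSchmidtWingberg2008]
* K. Rubin, *Euler Systems* (2000), App. B §2–§3 (maps into inverse limits are determined levelwise). [Rubin2000]
* J. H. Silverman, *AEC* (2009), III.6.1 (dual isogeny), III.7.4 (`T_ℓ φ`). [SilvermanAEC2009]
* Tree: `Kato2004/EulerSystemIsogenyTransport.lean` (the `ℚ`-twin: `tateRepHomSub`, `isogenyMapH1`, (T1)–(T3)),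
  `Kato2004/IwasawaCohomologyNumberField.lean` (`IwasawaH1DataOver`, `layerCoresOver`, `proj_smul`),
  `Kato2004/IwasawaCohomologyNumberFieldRestriction.lean` (the inverse-limit packaging pattern of `resOver`),
  `Kato2004/IwasawaH1Reduction.lean` (`mapH1AddHom_resLe/_coresLe/_conjMap`), `AlgebraicGeometry/Motives/FaltingsEC.lean`
  (`tateModule_map_smul`).
-/

noncomputable section

open scoped NumberField Polynomial
open CategoryTheory Field IsDedekindDomain Polynomial
open Literature.NumberTheory.GaloisRepresentations
open Literature.NumberTheory.EllipticCurves Literature.NumberTheory.EllipticCurves.Kato2004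
open Literature.NumberTheory.EllipticCurves.Kato2004.CM (tateRepK integralH1K mem_integralH1K_iff)

namespace Literature.NumberTheory.EllipticCurves.Kato2004

/-! ## §1 The push-forward `φ_* : H¹(U, T_pV) → H¹(U, T_pV′)` of a `K`-isogeny on every level `U ≤ Γ_K` -/

section Layer

variable {K : Type} [Field K] {V V' : WeierstrassCurve K} (p : ℕ) [Fact p.Prime]
  [ContinuousSMul ℤ_[p] (V.tateModule p)] [ContinuousSMul ℤ_[p] (V'.tateModule p)]

omit [ContinuousSMul ℤ_[p] (V.tateModule p)] [ContinuousSMul ℤ_[p] (V'.tateModule p)] in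
/-- `T_p f : T_pV → T_pV′` is continuous for the profinite topologies (coordinatewise a map between discrete sets) — the
tree's `continuous_tateModule_map` over an arbitrary base field. [cite: SilvermanAEC2009, III.7.4] -/
theorem continuous_tateModule_map_over (f : V.geomPoints →+ V'.geomPoints) :
    Continuous (TateModule.map p f) := by
  refine continuous_induced_rng.2 (continuous_pi fun n => ?_)
  change Continuous fun x : V.tateModule p => TateModule.proj p n (TateModule.map p f x)
  simp only [TateModule.proj_map]
  exact continuous_of_discreteTopology.comp (TateModule.continuous_proj n)

/-- **`T_p φ` as a morphism of topological representations of the level group `U ≤ Γ_K`**: `T_pV|_U → T_pV′|_U`, continuous,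
`ℤ_p`-linear and `U`-equivariant (`tateModule_map_smul`: `φ` is defined over `K`). [cite: SilvermanAEC2009, III.7.4] -/
def tateRepKHomSub (φ : WeierstrassCurve.Isogeny V V') (U : Subgroup (absoluteGaloisGroup K)) :
    subgroupRep (tateRepK V p).toTopRep U ⟶ subgroupRep (tateRepK V' p).toTopRep U :=
  TopRep.ofHom (ρ := (subgroupRep (tateRepK V p).toTopRep U).ρ)
    (σ := (subgroupRep (tateRepK V' p).toTopRep U).ρ)
    ⟨⟨TateModule.map p φ.toAddMonoidHom, continuous_tateModule_map_over p φ.toAddMonoidHom⟩,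
      fun g => ContinuousLinearMap.ext fun x =>
        Literature.AlgebraicGeometry.Motives.tateModule_map_smul p φ (g : absoluteGaloisGroup K) x⟩

/-- **The push-forward `φ_* : H¹(U, T_pV) →ₗ[ℤ_p] H¹(U, T_pV′)` of a `K`-isogeny `φ : V → V′`** on the continuous cohomology of
every `U ≤ Γ_K` (`[θ] ↦ [T_pφ ∘ θ]`; the `K`-twin of `isogenyMapH1`). [cite: SerreGaloisCohomology1997, I §2.2] -/
def isogenyLayerMapK (φ : WeierstrassCurve.Isogeny V V') (U : Subgroup (absoluteGaloisGroup K)) :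
    H1 (tateRepK V p) U →ₗ[ℤ_[p]] H1 (tateRepK V' p) U :=
  (cohomologyMap (tateRepKHomSub p φ U) 1).hom.toLinearMap

/-- `φ_*` is the tree's `mapH1AddHom` of the additive map `T_pφ`. [cite: SerreGaloisCohomology1997, I §2.2] -/
theorem isogenyLayerMapK_eq_mapH1AddHom (φ : WeierstrassCurve.Isogeny V V')
    (U : Subgroup (absoluteGaloisGroup K)) (c : H1 (tateRepK V p) U) :
    isogenyLayerMapK p φ U c =
      mapH1AddHom (subgroupRep (tateRepK V p).toTopRep U) (subgroupRep (tateRepK V' p).toTopRep U)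
        (TateModule.map p φ.toAddMonoidHom).toAddMonoidHom (continuous_tateModule_map_over p φ.toAddMonoidHom)
        (fun g x => Literature.AlgebraicGeometry.Motives.tateModule_map_smul p φ
          (g : absoluteGaloisGroup K) x) c :=
  cohomologyMap_one_eq_mapH1AddHom _ _ _ c

/-- `φ_*` on an explicit crossed homomorphism: `φ_* [θ] = [T_pφ ∘ θ]`. [cite: SerreGaloisCohomology1997, I §2.2] -/
theorem isogenyLayerMapK_oneCocycleClass (φ : WeierstrassCurve.Isogeny V V')
    (U : Subgroup (absoluteGaloisGroup K)) (θ : contOneCocycles (subgroupRep (tateRepK V p).toTopRep U)) :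
    isogenyLayerMapK p φ U (oneCocycleClass _ θ) =
      oneCocycleClass (subgroupRep (tateRepK V' p).toTopRep U)
        (contOneCocycles.pushAddHom (X := subgroupRep (tateRepK V p).toTopRep U)
          (Y := subgroupRep (tateRepK V' p).toTopRep U) (TateModule.map p φ.toAddMonoidHom).toAddMonoidHom
          (continuous_tateModule_map_over p φ.toAddMonoidHom)
          (fun g x => Literature.AlgebraicGeometry.Motives.tateModule_map_smul p φ
            (g : absoluteGaloisGroup K) x) θ) := by
  rw [isogenyLayerMapK_eq_mapH1AddHom, mapH1AddHom_oneCocycleClass]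

/-- **`φ_*` commutes with restriction** `res : H¹(U′, T) → H¹(U, T)` (`U ≤ U′`). [cite: SerreGaloisCohomology1997, I §2.4] -/
theorem isogenyLayerMapK_resLe (φ : WeierstrassCurve.Isogeny V V') {U U' : Subgroup (absoluteGaloisGroup K)}
    (h : U ≤ U') (c : H1 (tateRepK V p) U') :
    isogenyLayerMapK p φ U (resLe (tateRepK V p).toTopRep h 1 c) =
      resLe (tateRepK V' p).toTopRep h 1 (isogenyLayerMapK p φ U' c) := by
  rw [isogenyLayerMapK_eq_mapH1AddHom, isogenyLayerMapK_eq_mapH1AddHom]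
  exact mapH1AddHom_resLe _ _ h _ _ c

/-- **`φ_*` commutes with corestriction** `cor : H¹(U, T) → H¹(U′, T)` (`U ≤ U′`, `U` open of finite index).
[cite: SerreGaloisCohomology1997, I §2.4] [cite: NeukirchSchmidtWingberg2008, I §5 Prop. 1.5.4] -/
theorem isogenyLayerMapK_coresLe (φ : WeierstrassCurve.Isogeny V V') {U U' : Subgroup (absoluteGaloisGroup K)}
    (h : U ≤ U') (hUo : IsOpen (U : Set (absoluteGaloisGroup K))) [hF : Fintype (U' ⧸ U.subgroupOf U')]
    (c : H1 (tateRepK V p) U) :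
    isogenyLayerMapK p φ U' (coresLe (tateRepK V p).toTopRep h hUo c) =
      coresLe (tateRepK V' p).toTopRep h hUo (isogenyLayerMapK p φ U c) := by
  rw [isogenyLayerMapK_eq_mapH1AddHom, isogenyLayerMapK_eq_mapH1AddHom]
  exact mapH1AddHom_coresLe _ _ h hUo _ _ c

/-- **`φ_*` commutes with the conjugation action** of `σ ∈ Γ_K` on `H¹(U, T)` (`U` normal). [cite: NeukirchSchmidtWingberg2008, I §5] -/
theorem isogenyLayerMapK_conjMap (φ : WeierstrassCurve.Isogeny V V') (U : Subgroup (absoluteGaloisGroup K))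
    [U.Normal] (σ : absoluteGaloisGroup K) (c : H1 (tateRepK V p) U) :
    isogenyLayerMapK p φ U (conjMap (tateRepK V p).toTopRep U σ 1 c) =
      conjMap (tateRepK V' p).toTopRep U σ 1 (isogenyLayerMapK p φ U c) := by
  rw [isogenyLayerMapK_eq_mapH1AddHom, isogenyLayerMapK_eq_mapH1AddHom]
  exact mapH1AddHom_conjMap _ _
    (fun g x => Literature.AlgebraicGeometry.Motives.tateModule_map_smul p φ g x) σ _ c

/-- **`φ_*` preserves the integral classes `H¹(O_{K′}[1/p], T)`** (`integralH1K`: vanishing of the restriction to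
`U ⊓ I_𝔓` for every prime `𝔓` over a place `v ∤ p` — and `φ_*` commutes with that restriction).
[cite: Kato2004Asterisque, §8.1 (8.1.3) (p. 180) and §8.2, Lemma 8.5 (pp. 180–184)] -/
theorem isogenyLayerMapK_mem_integralH1K (φ : WeierstrassCurve.Isogeny V V')
    (U : Subgroup (absoluteGaloisGroup K)) {c : H1 (tateRepK V p) U} (hc : c ∈ integralH1K (tateRepK V p) p U) :
    isogenyLayerMapK p φ U c ∈ integralH1K (tateRepK V' p) p U := by
  rw [mem_integralH1K_iff] at hc ⊢
  intro v hv 𝔓 h𝔓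
  rw [← isogenyLayerMapK_resLe, hc v hv 𝔓 h𝔓, map_zero]

/-- **Dual isogeny on cohomology**: if `ψ ∘ φ = [n]` on `V(K̄)` then `ψ_* (φ_* c) = n • c` on `H¹(U, T_pV)`.
[cite: SilvermanAEC2009, Thm. III.6.1 (a) and III.7.4] -/
theorem isogenyLayerMapK_isogenyLayerMapK_of_comp_eq_zsmul (φ : WeierstrassCurve.Isogeny V V')
    (ψ : WeierstrassCurve.Isogeny V' V) {n : ℤ} (hψφ : ∀ P, ψ (φ P) = n • P)
    (U : Subgroup (absoluteGaloisGroup K)) (c : H1 (tateRepK V p) U) :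
    isogenyLayerMapK p ψ U (isogenyLayerMapK p φ U c) = n • c := by
  obtain ⟨θ, rfl⟩ := oneCocycleClass_surjective _ c
  have hzs : oneCocycleClass (subgroupRep (tateRepK V p).toTopRep U) (n • θ) =
      n • oneCocycleClass (subgroupRep (tateRepK V p).toTopRep U) θ :=
    map_zsmul (oneCocycleClassₗ (subgroupRep (tateRepK V p).toTopRep U)) n θ
  rw [isogenyLayerMapK_oneCocycleClass, isogenyLayerMapK_oneCocycleClass, ← hzs]
  refine congrArg _ (Subtype.ext (ContinuousMap.ext fun g => ?_))
  rw [contOneCocycles.pushAddHom_apply, contOneCocycles.pushAddHom_apply, AddSubgroupClass.coe_zsmul,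
    ContinuousMap.zsmul_apply]
  change TateModule.map p ψ.toAddMonoidHom (TateModule.map p φ.toAddMonoidHom (θ.1 g)) = n • θ.1 g
  refine TateModule.ext fun k => ?_
  rw [TateModule.proj_map, TateModule.proj_map, map_zsmul]
  exact hψφ _

variable {κ : ZpExtension K p}

/-- `φ_*` commutes with the layer trace maps `Cor : H¹(K_{n+1}, T) → H¹(K_n, T)` of a `ℤ_p`-extension `κ` of `K`.
[cite: Kato2004Asterisque, §12.2 (p. 220)] [cite: SerreGaloisCohomology1997, I §2.4] -/
theorem isogenyLayerMapK_layerCoresOver (φ : WeierstrassCurve.Isogeny V V') (n : ℕ)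
    (c : H1 (tateRepK V p) (κ.layerSubgroup (n + 1))) :
    isogenyLayerMapK p φ (κ.layerSubgroup n) (layerCoresOver (tateRepK V p) κ n c) =
      layerCoresOver (tateRepK V' p) κ n (isogenyLayerMapK p φ (κ.layerSubgroup (n + 1)) c) := by
  haveI : CompactSpace (absoluteGaloisGroup K) := absoluteGaloisGroup_compactSpace K
  haveI : (κ.layerSubgroup (n + 1)).FiniteIndex :=
    finiteIndex_of_isOpen_of_compactSpace _ (κ.isOpen_layerSubgroup (n + 1))
  letI : Fintype (κ.layerSubgroup n ⧸ (κ.layerSubgroup (n + 1)).subgroupOf (κ.layerSubgroup n)) :=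
    Fintype.ofFinite _
  rw [layerCoresOver_eq_coresLe, layerCoresOver_eq_coresLe]
  exact isogenyLayerMapK_coresLe p φ _ _ c

end Layer

/-! ## §2 The push-forward on the pinned inverse limit `𝐇¹_{K,Γ}(T_pV) → 𝐇¹_{K,Γ}(T_pV′)` -/

section Limit

variable {K : Type} [Field K] {V V' : WeierstrassCurve K} {p : ℕ} [Fact p.Prime]
  [ContinuousSMul ℤ_[p] (V.tateModule p)] [ContinuousSMul ℤ_[p] (V'.tateModule p)]
  {κ : ZpExtension K p} {γ : absoluteGaloisGroup K}

/-- A linear map intertwining two endomorphisms intertwines the polynomials in them. [folklore] -/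
private theorem map_aeval_apply_of_comp_eq_isog {N₁ N₂ : Type*} [AddCommGroup N₁] [Module ℤ_[p] N₁]
    [AddCommGroup N₂] [Module ℤ_[p] N₂] (g : N₁ →ₗ[ℤ_[p]] N₂) (a : Module.End ℤ_[p] N₁) (b : Module.End ℤ_[p] N₂)
    (hg : g ∘ₗ a = b ∘ₗ g) (r : ℤ_[p][X]) (m : N₁) : g (aeval a r m) = aeval b r (g m) := by
  induction r using Polynomial.induction_on generalizing m with
  | C c => simp
  | add f₁ f₂ h₁ h₂ => simp [h₁, h₂]
  | monomial k c hk =>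
    have hc : ∀ m, g (a m) = b (g m) := fun m => by simpa using LinearMap.congr_fun hg m
    rw [pow_succ, ← mul_assoc]
    conv_rhs => rw [map_mul, Module.End.mul_apply, aeval_X]
    conv_lhs => rw [map_mul, Module.End.mul_apply, aeval_X]
    rw [hk, hc]

/-- `φ_*` intertwines the LEVEL OPERATORS: `φ_* ∘ (conj_γ − 1) = (conj_γ − 1) ∘ φ_*` on `H¹(K_n, T_pV)`.
[cite: NeukirchSchmidtWingberg2008, I §5 Prop. 1.5.4] -/
theorem isogenyLayerMapK_comp_conj_sub_one (φ : WeierstrassCurve.Isogeny V V') (γ : absoluteGaloisGroup K)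
    (n : ℕ) :
    isogenyLayerMapK p φ (κ.layerSubgroup n) ∘ₗ
        ((conjMap (tateRepK V p).toTopRep (κ.layerSubgroup n) γ 1).hom.toLinearMap - 1) =
      ((conjMap (tateRepK V' p).toTopRep (κ.layerSubgroup n) γ 1).hom.toLinearMap - 1) ∘ₗ
        isogenyLayerMapK p φ (κ.layerSubgroup n) := by
  refine LinearMap.ext fun y ↦ ?_
  simp only [LinearMap.coe_comp, Function.comp_apply, LinearMap.sub_apply, Module.End.one_apply, map_sub]
  change isogenyLayerMapK p φ _ (conjMap (tateRepK V p).toTopRep (κ.layerSubgroup n) γ 1 y) - _ = _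
  rw [isogenyLayerMapK_conjMap]
  rfl

namespace IwasawaH1DataOver

variable (φ : WeierstrassCurve.Isogeny V V') (IK : IwasawaH1DataOver V p κ γ) (IK' : IwasawaH1DataOver V' p κ γ)

/-- The levelwise push-forwards of an element of `𝐇¹_{K,Γ}(T_pV)`: the family `(φ_* (proj n x))_n`. [cite: Kato2004Asterisque, §12.2 (p. 220)] -/
def isogenyFamily (x : IK.H) : ∀ n : ℕ, H1 (tateRepK V' p) (κ.layerSubgroup n) :=
  fun n ↦ isogenyLayerMapK p φ (κ.layerSubgroup n) (IK.proj n x)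

/-- Unfolding `isogenyFamily`. [cite: Kato2004Asterisque, §12.2 (p. 220)] -/
@[simp] theorem isogenyFamily_apply (x : IK.H) (n : ℕ) :
    IK.isogenyFamily φ x n = isogenyLayerMapK p φ (κ.layerSubgroup n) (IK.proj n x) := rfl

/-- The levelwise push-forwards of `x ∈ 𝐇¹_{K,Γ}(T_pV)` form a norm-compatible INTEGRAL family for `V′`
(`isogenyLayerMapK_mem_integralH1K`, `isogenyLayerMapK_layerCoresOver`, `cores_proj`). [cite: Kato2004Asterisque, §12.2 (p. 220)] -/
theorem isNormCompatibleOver_isogenyFamily (x : IK.H) :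
    IsNormCompatibleOver (tateRepK V' p) κ (IK.isogenyFamily φ x) :=
  ⟨fun n ↦ isogenyLayerMapK_mem_integralH1K p φ _ (IK.proj_mem n x),
    fun n ↦ by rw [isogenyFamily_apply, isogenyFamily_apply, ← isogenyLayerMapK_layerCoresOver, IK.cores_proj]⟩

/-- **The push-forward `φ_* : 𝐇¹_{K,Γ}(T_pV) → 𝐇¹_{K,Γ}(T_pV′)` of a `K`-isogeny on the PINNED inverse limits** `IK`, `IK′`
(same tower `κ`, same generator `γ`): the unique map with `IK′.proj n (φ_* x) = φ_* (IK.proj n x)` (`proj_isogenyMap`,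
`isogenyMap_unique`).  `Λ`-LINEAR: additive by construction; compatible with polynomials in `X` because `φ_*` intertwines the
level operators (`isogenyLayerMapK_comp_conj_sub_one`), and with all of `Λ` because both actions are levelwise through
`Λ/(ω_n)` (`IwasawaH1DataOver.proj_smul`).  For `V′ = V` and `φ` a CM endomorphism this is Kato's `O_λ`-action on `H^q(T)`
(15.14). [cite: Kato2004Asterisque, 15.14 (p. 264) and §12.2 (p. 220)] [cite: Rubin2000, App. B §3] -/
def isogenyMap (hγ : κ.IsTopGenerator γ) : IK.H →ₗ[IwasawaAlgebra p] IK'.H where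
  toFun x := (IK'.proj_surjective _ (IK.isNormCompatibleOver_isogenyFamily φ x)).choose
  map_add' x x' := IK'.proj_eq_iff.mp fun n ↦ by
    rw [map_add, (IK'.proj_surjective _ (IK.isNormCompatibleOver_isogenyFamily φ (x + x'))).choose_spec,
      (IK'.proj_surjective _ (IK.isNormCompatibleOver_isogenyFamily φ x)).choose_spec,
      (IK'.proj_surjective _ (IK.isNormCompatibleOver_isogenyFamily φ x')).choose_spec,
      isogenyFamily_apply, isogenyFamily_apply, isogenyFamily_apply, map_add, map_add]
  map_smul' f x := IK'.proj_eq_iff.mp fun n ↦ by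
    obtain ⟨r, hr⟩ := IwasawaH1Exists.exists_polynomial_sub_coe_mem_span p n f
    rw [RingHom.id_apply,
      (IK'.proj_surjective _ (IK.isNormCompatibleOver_isogenyFamily φ (f • x))).choose_spec,
      IK'.proj_smul hγ n hr,
      (IK'.proj_surjective _ (IK.isNormCompatibleOver_isogenyFamily φ x)).choose_spec,
      isogenyFamily_apply, isogenyFamily_apply, IK.proj_smul hγ n hr]
    exact map_aeval_apply_of_comp_eq_isog (isogenyLayerMapK p φ (κ.layerSubgroup n)) _ _
      (isogenyLayerMapK_comp_conj_sub_one (κ := κ) φ γ n) r (IK.proj n x)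

/-- **The defining property of `φ_*`**: `IK′.proj n (φ_* x) = φ_* (IK.proj n x)`. [cite: Kato2004Asterisque, §12.2 (p. 220)] -/
theorem proj_isogenyMap (hγ : κ.IsTopGenerator γ) (n : ℕ) (x : IK.H) :
    IK'.proj n (IK.isogenyMap φ IK' hγ x) = isogenyLayerMapK p φ (κ.layerSubgroup n) (IK.proj n x) :=
  (IK'.proj_surjective _ (IK.isNormCompatibleOver_isogenyFamily φ x)).choose_spec n

/-- **Uniqueness of `φ_*`**: any map `IK.H → IK′.H` computed levelwise by the `φ_*` IS `isogenyMap` (`IK′.proj` is jointly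
injective). [cite: Rubin2000, App. B §2–§3 (maps into an inverse limit are determined levelwise)] -/
theorem isogenyMap_unique (hγ : κ.IsTopGenerator γ) (g : IK.H → IK'.H)
    (hg : ∀ (n : ℕ) (x : IK.H), IK'.proj n (g x) = isogenyLayerMapK p φ (κ.layerSubgroup n) (IK.proj n x))
    (x : IK.H) : g x = IK.isogenyMap φ IK' hγ x :=
  IK'.proj_eq_iff.mp fun n ↦ by rw [hg, proj_isogenyMap]

/-- An element `y` with the right layers IS `φ_* x`. [cite: Rubin2000, App. B §2–§3] -/
theorem eq_isogenyMap_of_proj_eq (hγ : κ.IsTopGenerator γ) {x : IK.H} {y : IK'.H}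
    (hy : ∀ n : ℕ, IK'.proj n y = isogenyLayerMapK p φ (κ.layerSubgroup n) (IK.proj n x)) :
    y = IK.isogenyMap φ IK' hγ x :=
  IK'.proj_eq_iff.mp fun n ↦ by rw [hy, proj_isogenyMap]

/-- **Functoriality / dual isogeny on `𝐇¹_{K,Γ}`**: if `ψ ∘ φ = [n]` on `V(K̄)` then `ψ_* (φ_* x) = n • x`.
[cite: SilvermanAEC2009, Thm. III.6.1 (a) and III.7.4] [cite: Kato2004Asterisque, §8.1 (8.1.3) (p. 180)] -/
theorem isogenyMap_isogenyMap_of_comp_eq_zsmul (hγ : κ.IsTopGenerator γ) (ψ : WeierstrassCurve.Isogeny V' V)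
    {n : ℤ} (hψφ : ∀ P, ψ (φ P) = n • P) (x : IK.H) :
    IK'.isogenyMap ψ IK hγ (IK.isogenyMap φ IK' hγ x) = n • x :=
  IK.proj_eq_iff.mp fun k ↦ by
    rw [proj_isogenyMap, proj_isogenyMap, isogenyLayerMapK_isogenyLayerMapK_of_comp_eq_zsmul p φ ψ hψφ,
      map_zsmul]

/-- **The square of a CM-type endomorphism on `𝐇¹_{K,Γ}(T_pV)`**: if `φ ∘ φ = [m]` on `V(K̄)` (e.g. `φ = √−D`, `m = −D`) then
`φ_* (φ_* x) = m • x` — the relation `π² = −D` of the `O_K ⊗ ℤ_p`-module structure of `H¹_Iw(Kℚ_∞/K, T_pW)` through the CM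
endomorphisms. [cite: Kato2004Asterisque, 15.14 (p. 264, "O_λ[[G′_∞]]-modules")] [cite: SilvermanAEC2009, III.7.4] -/
theorem isogenyMap_sq_of_comp_self_eq_zsmul (hγ : κ.IsTopGenerator γ) (φ : WeierstrassCurve.Isogeny V V)
    {m : ℤ} (hφ : ∀ P, φ (φ P) = m • P) (x : IK.H) :
    IK.isogenyMap φ IK hγ (IK.isogenyMap φ IK hγ x) = m • x :=
  IK.isogenyMap_isogenyMap_of_comp_eq_zsmul φ IK hγ φ hφ x

/-- `φ_*` commutes with the `Λ`-action (it is `Λ`-linear; recorded for rewriting). [cite: Kato2004Asterisque, 15.14 (p. 264)] -/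
theorem isogenyMap_smul (hγ : κ.IsTopGenerator γ) (f : IwasawaAlgebra p) (x : IK.H) :
    IK.isogenyMap φ IK' hγ (f • x) = f • IK.isogenyMap φ IK' hγ x :=
  map_smul _ f x

end IwasawaH1DataOver

end Limit

end Literature.NumberTheory.EllipticCurves.Kato2004

end
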